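import Summits.CriticalPhenomena.PercolationContinuityZ3.Theorems.PercNearOneGluingNoHeavyLowerTailSahiCombJunta
import Summits.CriticalPhenomena.PercolationContinuityZ3.Theorems.PercNearOneGluingNoHeavyLowerTailSahiC3CombCubeFive

/-!
# The junta-intersection theorem with FIVE coordinates — computational companion of `…SahiCombJunta` / `…SahiCombJuntaFour`
# (through (M⁺-3) on five letters, …`SahiC3CombCubeFive`)

Support file (cell `prim-sahi`, seat `prim-sahi-typer` gen 33; `--supports stmt-CriticalPhenomena-4575`; proposed `--computational`: every theorem here
has the nine pre-existing `native_decide` axioms of `SahiC3CombCube.combPos_sahiE_three_of_card_le_five` (the eight `colourCheck_five` chunks and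
`checkCube_four`) in its closure; nothing else non-standard, no `sorry`).

P3's junta-intersection theorem (`SahiCombJunta.combPos_sahiE_three_of_inter_determinedBy`): if (M⁺-3) holds on the cube `↥W` then, IN EVERY DIMENSION,
`p ↦ E₃(μ_p; 1_U, 1_A, 1_B)` is comb-positive for every increasing `U` and all increasing `A, B` whose INTERSECTION `A ∩ B` is determined by the
coordinates in `W`.  With `|W| ≤ 3` (kernel) and `|W| ≤ 4` (`…SahiCombJuntaFour`, `checkCube_four`) in the tree, (M⁺-3) on five letters (this generation)
gives the five-coordinate class:

* `cubeCombPos3_of_card_le_five` — (M⁺-3) on every cube `↥W` with `|W| ≤ 5`;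
* **`combPos_sahiE_three_of_inter_determinedBy_card_le_five`** — `A ∩ B` determined by at most FIVE coordinates ⟹ (M⁺-3) for `(U, A, B)`, every
  increasing `U`, every finite ground set;
* the law-level corollary (Kahn's Conjecture 5 / Sahi's `C₃` for every product measure on this class, every dimension) and the three-partition
  corollary (every twist); and `combPos_sahiE_three_of_determinedBy_all_card_le_five` — all three events determined by a common set of `≤ 5` coordinates.
HONEST LABEL: computational (closure as stated); Kahn's Conjecture 5 in general remains OPEN. [this work]
-/

noncomputable section

open scoped Classical

namespace Summit.CriticalPhenomena.PercolationContinuityZ3.Theorems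

namespace SahiCombJunta

open Finset Function
open Literature.Combinatorics.Sahi2008
open Literature.Probability.Percolation (DeterminedBy)
open Literature.Probability.Percolation.DecisionTree (ind)
open SahiComb

variable {ι : Type} [Fintype ι]

/-- (M⁺-3) on the cube `↥W` for `|W| ≤ 5` (coloured-antichain certificate `colourCheck_five` read at comb level). [this work] [computational] -/
theorem cubeCombPos3_of_card_le_five (W : Set ι) (hW : Fintype.card ↥W ≤ 5) : CubeCombPos3 W :=
  fun _ _ _ hX hY hZ => SahiC3CombCube.combPos_sahiE_three_of_card_le_five hW hX hY hZ

/-- **Junta-intersection with five coordinates**: if `A ∩ B` is determined by a set `W` of at most five coordinates, then (M⁺-3) holds for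
`(U, A, B)` for every increasing `U`, in every dimension. [this work] [computational] -/
theorem combPos_sahiE_three_of_inter_determinedBy_card_le_five (W : Finset ι) (hW : W.card ≤ 5) {U A B : Set (Set ι)}
    (hU : IsUpperSet U) (hA : IsUpperSet A) (hB : IsUpperSet B) (hK : DeterminedBy (A ∩ B) (↑W : Set ι)) :
    CombPos (fun _ : ι => 3) (fun p => sahiE (bernoulliWeight p) 3 ![ind U, ind A, ind B]) :=
  combPos_sahiE_three_of_inter_determinedBy W (cubeCombPos3_of_card_le_five _ (by
    rw [← Set.toFinset_card, Finset.toFinset_coe]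
    exact hW)) hU hA hB hK

/-- Law level: `E₃(μ_p; U, A, B) ≥ 0` whenever `A ∩ B` depends on at most five coordinates (every product measure, every dimension) — Kahn's
Conjecture 5 on this class. [this work] [computational] -/
theorem sahiE_three_ind_nonneg_of_inter_determinedBy_card_le_five (p : ι → unitInterval) (W : Finset ι) (hW : W.card ≤ 5)
    {U A B : Set (Set ι)} (hU : IsUpperSet U) (hA : IsUpperSet A) (hB : IsUpperSet B) (hK : DeterminedBy (A ∩ B) (↑W : Set ι)) :
    0 ≤ sahiE (bernoulliWeight p) 3 ![ind U, ind A, ind B] :=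
  (combPos_sahiE_three_of_inter_determinedBy_card_le_five W hW hU hA hB hK).nonneg p

/-- (★★) on the five-coordinate junta class: `threePartNT τ U A B ≥ 0` for every twist. [this work] [computational] -/
theorem threePartNT_nonneg_of_inter_determinedBy_card_le_five (τ : Set ι) (W : Finset ι) (hW : W.card ≤ 5) {U A B : Set (Set ι)}
    (hU : IsUpperSet U) (hA : IsUpperSet A) (hB : IsUpperSet B) (hK : DeterminedBy (A ∩ B) (↑W : Set ι)) :
    0 ≤ ThreePartition.threePartNT τ U A B :=
  ThreePartition.threePartNT_nonneg_of_combPos τ (combPos_sahiE_three_of_inter_determinedBy_card_le_five W hW hU hA hB hK)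

/-- All three events determined by a common set of at most five coordinates: (M⁺-3) in every dimension (sub-cube transport
`combPos_sahiE_three_of_determinedBy_all`). [this work] [computational] -/
theorem combPos_sahiE_three_of_determinedBy_all_card_le_five (W : Finset ι) (hW : W.card ≤ 5) {X Y Z : Set (Set ι)}
    (hX : IsUpperSet X) (hY : IsUpperSet Y) (hZ : IsUpperSet Z) (hXd : DeterminedBy X (↑W : Set ι)) (hYd : DeterminedBy Y (↑W : Set ι))
    (hZd : DeterminedBy Z (↑W : Set ι)) :
    CombPos (fun _ : ι => 3) (fun p => sahiE (bernoulliWeight p) 3 ![ind X, ind Y, ind Z]) :=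
  combPos_sahiE_three_of_determinedBy_all (↑W : Set ι) (cubeCombPos3_of_card_le_five _ (by
    rw [← Set.toFinset_card, Finset.toFinset_coe]
    exact hW)) hX hY hZ hXd hYd hZd

end SahiCombJunta

end Summit.CriticalPhenomena.PercolationContinuityZ3.Theorems
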